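import Summits.Ventures.PercRepro.RankLevelSetLevelFiveCqEighteen
import Summits.Ventures.PercRepro.S1LevelFourG
import Summits.Ventures.PercRepro.S2CoreSixteen
import Summits.Ventures.PercRepro.S2SixteenSixTen
import Summits.Ventures.PercRepro.S2SixteenSevenColoop
import Summits.Ventures.PercRepro.S2SixteenEight
import Summits.Ventures.PercRepro.S2SixteenNine
import Summits.Ventures.PercRepro.S2SixteenEleven
import Summits.Ventures.PercRepro.S2SixteenTwelve
import Summits.Ventures.PercRepro.S2SixteenThirteen
import Summits.Ventures.PercRepro.S2SixteenFourteen
import Summits.Ventures.PercRepro.S2SixteenFifteen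
import Summits.Ventures.PercRepro.S2SixteenSixteen
import Summits.Ventures.PercRepro.S2SixteenSeventeen
import Summits.Ventures.PercRepro.S2CellsP16R
import Summits.Ventures.PercRepro.S2CellsP16RB

/-!
# PercRepro — THEOREM C₅ AT `17`: C-025 AT LEVEL `5` FOR EVERY `p ≥ 17` (p7, gen 10; sub-claim S2; the «17» assembly)

The `p = 16` row of the `q = 5` window, cell by cell: `(16, 6)` (the cobasis-T core with the coloop-free caps + the double coloop split,
S2SixteenSixTen), `(16, 7)` (S2SixteenSevenColoop), `(16, 8)` (S2SixteenEight), `(16, 9)` (S2SixteenNine), `(16, 10)` (the quart XMid core,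
S2SixteenSixTen), `(16, 11 … 17)` (S2SixteenEleven … S2SixteenSeventeen) — the nested dichotomy on «a set `W` of nullity `k` on `≤ 5 + k` points»
where the kit's caps alone do not reach —, `(16, 18 … 33)` on the quart core with the kit's standard caps (S2CellsP16R / RB, dispatched by
**`S2.cellsP16Q`**), and corank `≥ 34` by the sum key at `n₀ = 50` (S2CoreSixteen). Then:
* **`c025_core_five_sixteen_xx`** — the `e`-free core at level `5`, rank `16`, every corank `6 ≤ d ≤ 33`;
* **`c025_five_of_four_cq_xvii_from`** — level `4` for all `p ≥ P ≥ 16` implies level `5` for all `p ≥ P + 1` (the `p = 16` row here, the rows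
  `p ≥ 17` by the «18» kit's `c025_five_of_four_cq_xviii_from`);
* **`c025_five_large_sharp17`** — UNCONDITIONAL over the landed tree: C-025 at level `5` for every `p ≥ 17` (level `4` from S1's
  `c025_four_sixteen`); `c025_five_large_sharp17'` is the `C025` spelling.
Axioms: standard.
-/

open scoped Matroid

namespace PercRepro

namespace S2

/-- **The `p = 16` cells on the quart core, dispatched**: for every corank `18 ≤ d ≤ 33`, some slack `m ≤ 1024` with
`1024·U‴(16, d) ≤ (1024 − m)·2^(d−5)·C(21, 5)` and `1024·T‴(16 + d, d) ≤ m·2^(16+d)`, at `s3b = cq3 d`, `s4b = ThmN.avgChain16 d`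
and `s5b = avgChain5b d` (the caps of S2CellsP16R / RB). -/
theorem cellsP16Q (d : ℕ) (hd18 : 18 ≤ d) (hd33 : d ≤ 33) :
    ∃ m : ℕ, m ≤ 1024 ∧
      (1024 * ((((16 + d).choose 5 : ℚ) - (TriangleCap.cq3 d : ℚ) * ((16 + d - 3).choose 2 : ℚ) +
        (((TriangleCap.cq3 d).choose 2 : ℕ) : ℚ)) +
      (∑ j ∈ Finset.range (d - 5), (Nat.choose (min 13 ((d + 6) / 2 + 1 - 2)) j : ℚ) / (((j + 1) + 3 * (j + 1).choose 2 + 3 * (j + 1).choose 3 + 2 * (j + 1).choose 4 : ℕ) : ℚ)) *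
        ((TriangleCap.cq3 d * (16 + d - 3).choose 3 + ThmN.avgChain16 d * (16 + d - 4).choose 2 + S1.avgChain5b d * (16 + d - 5) + (d + 5).choose 6 : ℕ) : ℚ) +
      ((∑ j ∈ Finset.range (d - 5), (Nat.choose (min 19 (5 + d) - 6) j : ℚ) / (((j + 1) + 3 * (j + 1).choose 2 + 3 * (j + 1).choose 3 + 2 * (j + 1).choose 4 : ℕ) : ℚ)) -
        (∑ j ∈ Finset.range (d - 5), (Nat.choose (min 13 ((d + 6) / 2 + 1 - 2)) j : ℚ) / (((j + 1) + 3 * (j + 1).choose 2 + 3 * (j + 1).choose 3 + 2 * (j + 1).choose 4 : ℕ) : ℚ))) *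
        ((min 19 (5 + d)).choose 6 : ℚ)) ≤
        ((1024 - m : ℕ) : ℚ) * 2 ^ (d - 5) * ((16 + 5).choose 5 : ℚ)) ∧
      (1024 * ((((16 + d).choose 4 : ℚ) +
      (∑ j ∈ Finset.range 6, (Nat.choose (min 5 ((d + 3) / 2 + 1 - 2)) j : ℚ) / (((j + 1) + 3 * (j + 1).choose 2 + 3 * (j + 1).choose 3 + 2 * (j + 1).choose 4 : ℕ) : ℚ)) *
        ((TriangleCap.cq3 d * (16 + d - 3).choose 2 + ThmN.avgChain16 d * (16 + d - 4) + S1.avgChain5b d : ℕ) : ℚ) +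
      ((∑ j ∈ Finset.range 6, (Nat.choose 5 j : ℚ) / (((j + 1) + 3 * (j + 1).choose 2 + 3 * (j + 1).choose 3 + 2 * (j + 1).choose 4 : ℕ) : ℚ)) -
        (∑ j ∈ Finset.range 6, (Nat.choose (min 5 ((d + 3) / 2 + 1 - 2)) j : ℚ) / (((j + 1) + 3 * (j + 1).choose 2 + 3 * (j + 1).choose 3 + 2 * (j + 1).choose 4 : ℕ) : ℚ))) *
        ((10 : ℕ).choose 5 : ℚ)) +
      (((16 + d).choose 3 * 2 ^ 3 + (16 + d).choose 2 * 2 + (16 + d) + 1 : ℕ) : ℚ) +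
      (((16 + d).choose 5 : ℚ) + (∑ j ∈ Finset.range (d), (Nat.choose (min 13 ((d + 6) / 2 + 1 - 2)) j : ℚ) / (((j + 1) + 3 * (j + 1).choose 2 + 3 * (j + 1).choose 3 + 2 * (j + 1).choose 4 : ℕ) : ℚ)) * ((TriangleCap.cq3 d * (16 + d - 3).choose 3 + ThmN.avgChain16 d * (16 + d - 4).choose 2 + S1.avgChain5b d * (16 + d - 5) + (d + 5).choose 6 : ℕ) : ℚ) +
        ((∑ j ∈ Finset.range (d), (Nat.choose (min 19 (5 + d) - 6) j : ℚ) / (((j + 1) + 3 * (j + 1).choose 2 + 3 * (j + 1).choose 3 + 2 * (j + 1).choose 4 : ℕ) : ℚ)) - (∑ j ∈ Finset.range (d), (Nat.choose (min 13 ((d + 6) / 2 + 1 - 2)) j : ℚ) / (((j + 1) + 3 * (j + 1).choose 2 + 3 * (j + 1).choose 3 + 2 * (j + 1).choose 4 : ℕ) : ℚ))) *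
        ((min 19 (5 + d)).choose 6 : ℚ)) +
      ((∑ j ∈ Finset.range (d + 1), (16 + d).choose j : ℕ) : ℚ)) ≤ (m : ℚ) * 2 ^ (16 + d)) := by
  interval_cases d
  · rw [show TriangleCap.cq3 18 = 71 by decide +kernel, show ThmN.avgChain16 18 = 1208 by decide +kernel,
      show S1.avgChain5b 18 = 17004 by decide +kernel]
    exact ⟨715, by norm_num, cellP16R_18_poly, cellP16R_18_tail⟩
  · rw [show TriangleCap.cq3 19 = 81 by decide +kernel, show ThmN.avgChain16 19 = 1449 by decide +kernel,
      show S1.avgChain5b 19 = 21478 by decide +kernel]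
    exact ⟨770, by norm_num, cellP16R_19_poly, cellP16R_19_tail⟩
  · rw [show TriangleCap.cq3 20 = 92 by decide +kernel, show ThmN.avgChain16 20 = 1725 by decide +kernel,
      show S1.avgChain5b 20 = 26847 by decide +kernel]
    exact ⟨818, by norm_num, cellP16R_20_poly, cellP16R_20_tail⟩
  · rw [show TriangleCap.cq3 21 = 104 by decide +kernel, show ThmN.avgChain16 21 = 2038 by decide +kernel,
      show S1.avgChain5b 21 = 33239 by decide +kernel]
    exact ⟨859, by norm_num, cellP16R_21_poly, cellP16R_21_tail⟩
  · rw [show TriangleCap.cq3 22 = 117 by decide +kernel, show ThmN.avgChain16 22 = 2392 by decide +kernel,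
      show S1.avgChain5b 22 = 40793 by decide +kernel]
    exact ⟨894, by norm_num, cellP16R_22_poly, cellP16R_22_tail⟩
  · rw [show TriangleCap.cq3 23 = 131 by decide +kernel, show ThmN.avgChain16 23 = 2790 by decide +kernel,
      show S1.avgChain5b 23 = 49661 by decide +kernel]
    exact ⟨923, by norm_num, cellP16R_23_poly, cellP16R_23_tail⟩
  · rw [show TriangleCap.cq3 24 = 146 by decide +kernel, show ThmN.avgChain16 24 = 3236 by decide +kernel,
      show S1.avgChain5b 24 = 60007 by decide +kernel]
    exact ⟨946, by norm_num, cellP16R_24_poly, cellP16R_24_tail⟩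
  · rw [show TriangleCap.cq3 25 = 162 by decide +kernel, show ThmN.avgChain16 25 = 3733 by decide +kernel,
      show S1.avgChain5b 25 = 72008 by decide +kernel]
    exact ⟨965, by norm_num, cellP16R_25_poly, cellP16R_25_tail⟩
  · rw [show TriangleCap.cq3 26 = 179 by decide +kernel, show ThmN.avgChain16 26 = 4286 by decide +kernel,
      show S1.avgChain5b 26 = 85855 by decide +kernel]
    exact ⟨979, by norm_num, cellP16R_26_poly, cellP16R_26_tail⟩
  · rw [show TriangleCap.cq3 27 = 197 by decide +kernel, show ThmN.avgChain16 27 = 4898 by decide +kernel,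
      show S1.avgChain5b 27 = 101754 by decide +kernel]
    exact ⟨991, by norm_num, cellP16R_27_poly, cellP16R_27_tail⟩
  · rw [show TriangleCap.cq3 28 = 216 by decide +kernel, show ThmN.avgChain16 28 = 5573 by decide +kernel,
      show S1.avgChain5b 28 = 119924 by decide +kernel]
    exact ⟨1000, by norm_num, cellP16R_28_poly, cellP16R_28_tail⟩
  · rw [show TriangleCap.cq3 29 = 236 by decide +kernel, show ThmN.avgChain16 29 = 6316 by decide +kernel,
      show S1.avgChain5b 29 = 140600 by decide +kernel]
    exact ⟨1006, by norm_num, cellP16R_29_poly, cellP16R_29_tail⟩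
  · rw [show TriangleCap.cq3 30 = 465 by decide +kernel, show ThmN.avgChain16 30 = 7130 by decide +kernel,
      show S1.avgChain5b 30 = 164033 by decide +kernel]
    exact ⟨1011, by norm_num, cellP16R_30_poly, cellP16R_30_tail⟩
  · rw [show TriangleCap.cq3 31 = 496 by decide +kernel, show ThmN.avgChain16 31 = 8021 by decide +kernel,
      show S1.avgChain5b 31 = 190489 by decide +kernel]
    exact ⟨1015, by norm_num, cellP16R_31_poly, cellP16R_31_tail⟩
  · rw [show TriangleCap.cq3 32 = 528 by decide +kernel, show ThmN.avgChain16 32 = 8993 by decide +kernel,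
      show S1.avgChain5b 32 = 220252 by decide +kernel]
    exact ⟨1018, by norm_num, cellP16R_32_poly, cellP16R_32_tail⟩
  · rw [show TriangleCap.cq3 33 = 561 by decide +kernel, show ThmN.avgChain16 33 = 10051 by decide +kernel,
      show S1.avgChain5b 33 = 253623 by decide +kernel]
    exact ⟨1020, by norm_num, cellP16R_33_poly, cellP16R_33_tail⟩

end S2

namespace ThmN

open Set

variable {α : Type}

/-- **The `e`-free core at level `5`, rank `16`, every corank `6 ≤ d ≤ 33`**. -/
theorem c025_core_five_sixteen_xx (M : Matroid α) [M.Finite] (d : ℕ)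
    (hd6 : 6 ≤ d) (hd33 : d ≤ 33) (hR : M.eRank = ((16 : ℕ) : ℕ∞)) (hn : M.E.ncard = 16 + d)
    (hfree : ∀ e ∈ M.E, ∃ A ⊆ M.E \ {e}, e ∉ M.closure A ∧ e ∉ M.closure ((M.E \ {e}) \ A)) :
    RLS M 16 5 := by
  by_cases h6 : d = 6
  · subst h6; exact c025_core_five_sixteen_six M hR hn hfree
  by_cases h7 : d = 7
  · subst h7; exact c025_core_five_sixteen_seven M hR hn hfree
  by_cases h8 : d = 8
  · subst h8; exact c025_core_five_sixteen_eight M hR hn hfree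
  by_cases h9 : d = 9
  · subst h9; exact c025_core_five_sixteen_nine M hR hn hfree
  by_cases h10 : d = 10
  · subst h10; exact c025_core_five_sixteen_ten M hR hn hfree
  by_cases h11 : d = 11
  · subst h11; exact c025_sixteen_eleven M hR hn hfree
  by_cases h12 : d = 12
  · subst h12; exact c025_sixteen_twelve M hR hn hfree
  by_cases h13 : d = 13
  · subst h13; exact c025_sixteen_thirteen M hR hn hfree
  by_cases h14 : d = 14
  · subst h14; exact c025_sixteen_fourteen M hR hn hfree
  by_cases h15 : d = 15
  · subst h15; exact c025_sixteen_fifteen M hR hn hfree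
  by_cases h16 : d = 16
  · subst h16; exact c025_sixteen_sixteen M hR hn hfree
  by_cases h17 : d = 17
  · subst h17; exact c025_sixteen_seventeen M hR hn hfree
  have hd : M.E.encard = M.eRank + d := by
    rw [hR, ← M.ground_finite.cast_ncard_eq, hn]
    push_cast
    ring
  have hs3 := TriangleCap.core_ncard_triangles_le_cq3 M hfree hd
  have hs4 := ncard_fourCircuits_le_avgChain16 d M hfree hd
  have hs5 := S1.ncard_fiveCircuits_le_avgChain5b d M hfree hd
  exact c025_core_five_sharp_cell_xqictq5 M 16 d hd6 (by norm_num) hR hn hfree (TriangleCap.cq3 d) (avgChain16 d)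
    (S1.avgChain5b d) hs3 hs4 hs5 (S2.cellsP16Q d (by omega) hd33)

/-- **THEOREM C₅, GIVEN LEVEL `4` FROM `P ≥ 16`**: level `4` for all `p ≥ P` implies level `5` for all `p ≥ P + 1`
(the `p = 16` row by `c025_core_five_sixteen_xx` / `c025_core_five_at_sixteen_big`, the `p = 17` row by the «18» kit's
`c025_core_five_seventeen_xx` / `c025_core_five_at_seventeen_big`, the rows `p ≥ 18` by `c025_five_of_four_cq_xviii_from`). -/
theorem c025_five_of_four_cq_xvii_from (P : ℕ) (hP : 16 ≤ P)
    (h4 : ∀ (M : Matroid α) [M.Finite] (p : ℕ), P ≤ p → RLS M p 4) :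
    ∀ (M : Matroid α) [M.Finite] (p : ℕ), P + 1 ≤ p → RLS M p 5 := by
  rcases Nat.lt_or_ge P 17 with hP16 | hP17
  · have hP' : P = 16 := by omega
    subst hP'
    refine S2.rls_five_of_four_of_core 16 (by omega) h4 ?_
    intro M _ p hP' hR hbig hfree
    rcases Nat.lt_or_ge p 17 with h16 | h17
    · have hp' : p = 16 := by omega
      subst hp'
      rcases Nat.lt_or_ge M.E.ncard (16 + 34) with h | h
      · exact c025_core_five_sixteen_xx M (M.E.ncard - 16) (by omega) (by omega) hR (by omega) hfree
      · exact c025_core_five_at_sixteen_big M (by omega) hfree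
    rcases Nat.lt_or_ge p 18 with h17' | h18
    · have hp' : p = 17 := by omega
      subst hp'
      rcases Nat.lt_or_ge M.E.ncard (17 + 32) with h | h
      · exact c025_core_five_seventeen_xx M (M.E.ncard - 17) (by omega) (by omega) hR (by omega) hfree
      · exact c025_core_five_at_seventeen_big M (by omega) hfree
    · exact c025_five_of_four_cq_xviii_from 17 le_rfl (fun M _ p hp => h4 M p (by omega)) M p h18
  · exact c025_five_of_four_cq_xviii_from P hP17 h4

/-- **THEOREM C₅ AT `17`**: every finite matroid satisfies C-025 at level `5` for every `p ≥ 17` (level `4` from S1's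
`c025_four_sixteen`). -/
theorem c025_five_large_sharp17 (M : Matroid α) [M.Finite] (p : ℕ) (hp : 17 ≤ p) : RLS M p 5 :=
  c025_five_of_four_cq_xvii_from 16 le_rfl (fun M _ p hp => S1.c025_four_sixteen M p hp) M p hp

/-- The level-`5` statement at `p ≥ 17` in the vocabulary of `C025`. -/
theorem c025_five_large_sharp17' (M : Matroid α) [M.Finite] (p : ℕ) (hp : 17 ≤ p) :
    phiK p 5 * ({A : Set α | A ⊆ M.E ∧ M.eRk A = (p : ℕ∞) ∧ M.eRk (M.E \ A) = (5 : ℕ∞)}.ncard : ℚ) ≤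
      ({A : Set α | A ⊆ M.E ∧ (5 : ℕ∞) < M.eRk A ∧ M.eRk A < (p : ℕ∞)}.ncard : ℚ) :=
  c025_five_large_sharp17 M p hp

end ThmN

end PercRepro
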